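import Mathlib.Analysis.PSeries
import Mathlib.Analysis.Complex.Basic
import Mathlib.Topology.Algebra.InfiniteSum.Real
import Mathlib.Algebra.Order.BigOperators.Ring.Finset
import HarnessLib

/-!
# Conformal removability: rays in a rooted Whitney graph (tails of Jones–Smirnov's tree family)

Support for the proof of `JonesSmirnov2000_frontier_of_isHolderDomain` (Jones–Smirnov 2000,
Cor. 2; `ConformalRemovability.lean`). In the proof of Theorem 2 (P. W. Jones, S. K. Smirnov,
Ark. Mat. 38 (2000), §3, pp. 273–274) the Whitney cubes of `Ω` are organised into a tree rooted
at the cube of the base point (`q(Q)` = number of steps to the root), the curve family `Γ'`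
consists of the chains of segments between centres of consecutive cubes, and the hypothesis
`Σ_Q q(Q)ⁿ l(Q)ⁿ < ∞` makes all tails short, uniformly: by Hölder's inequality
`length(γ_k) ≍ Σ_{j ≥ k} l(Q_j) ≤ (Σ_j jⁿ l(Q_j)ⁿ)^{1/n} (Σ_{j ≥ k} j^{-n/(n-1)})^{(n-1)/n} → 0`
(p. 274, top), so every curve of the family lands at a boundary point.

This file proves the planar (`n = 2`) tail estimate for an ABSTRACT rooted graph: vertices `V`,
a `parent` map, a level function `q` with `q v = q (parent v) + 1` off the root, radii
`rad ≥ 0` with `Σ_v (q v + 1)² rad v² < ∞`, and positions `pos : V → ℂ` with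
`|pos v - pos (parent v)| ≤ κ (rad v + rad (parent v))`. A RAY is a sequence `x : ℕ → V` with
`parent (x (n+1)) = x n` (and `x (n+1) ≠ root`).

* `q_apply_ray`, `injective_ray` — levels along a ray are `q (x 0) + n`; rays are injective.
* `sum_range_rad_ray_le` — Cauchy–Schwarz along a ray:
  `Σ_{n<N} rad (x (k+n)) ≤ √(Σ_v (q v+1)² rad v²) · √(2/(q (x 0) + k + 1))`;
  `summable_rad_ray`, `tsum_rad_ray_le` — the tail sums of radii along a ray.
* `cauchySeq_pos_ray`, `exists_tendsto_pos_ray` — positions along a ray converge (the ray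
  LANDS); `dist_pos_ray_le` — the landing point is within
  `2κ √(Σ_v (q v+1)² rad v²) √(2/(q (x 0) + k + 1))` of `pos (x k)`, uniformly in the ray.

## References

* [JonesSmirnov2000] P. W. Jones, S. K. Smirnov, *Removability theorems for Sobolev functions and
  quasiconformal maps*, Ark. Mat. 38 (2000) 263–279, §3, proof of Thm. 2 (pp. 273–274).
-/

noncomputable section

open Set Filter Finset
open scoped Topology BigOperators

namespace Literature.Probability.RandomPlanarGeometry

section Rays

variable {V : Type*} {root : V} {parent : V → V} {q : V → ℕ} {rad : V → ℝ} {pos : V → ℂ}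
  {κ : ℝ} {x : ℕ → V}

/-- Along a ray the level increases by one at each step: `q (x n) = q (x 0) + n`. [folklore] -/
theorem q_apply_ray (hq : ∀ v, v ≠ root → q v = q (parent v) + 1)
    (hx : ∀ n, parent (x (n + 1)) = x n) (hx0 : ∀ n, x (n + 1) ≠ root) (n : ℕ) :
    q (x n) = q (x 0) + n := by
  induction n with
  | zero => simp
  | succ n ih => rw [hq _ (hx0 n), hx n, ih]; ring

/-- A ray visits no vertex twice. [folklore] -/
theorem injective_ray (hq : ∀ v, v ≠ root → q v = q (parent v) + 1)
    (hx : ∀ n, parent (x (n + 1)) = x n) (hx0 : ∀ n, x (n + 1) ≠ root) :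
    Function.Injective x := by
  intro m n h
  have := congrArg q h
  rw [q_apply_ray hq hx hx0 m, q_apply_ray hq hx hx0 n] at this
  omega

/-- `Σ_{n < N} 1/(m + 1 + n)² ≤ 2/(m + 1)` (tail of `Σ 1/i²`; Mathlib's `sum_Ioo_inv_sq_le`).
[folklore] -/
theorem sum_range_inv_sq_le (m N : ℕ) :
    ∑ n ∈ range N, (1 : ℝ) / ((m : ℝ) + 1 + n) ^ 2 ≤ 2 / ((m : ℝ) + 1) := by
  have h := sum_Ioo_inv_sq_le (α := ℝ) m (m + 1 + N)
  calc ∑ n ∈ range N, (1 : ℝ) / ((m : ℝ) + 1 + n) ^ 2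
      = ∑ i ∈ (range N).map (addLeftEmbedding (m + 1)), ((i : ℝ) ^ 2)⁻¹ := by
        rw [sum_map]
        refine sum_congr rfl fun n _ => ?_
        simp only [addLeftEmbedding_apply, Nat.cast_add, Nat.cast_one, one_div]
    _ = ∑ i ∈ Ioo m (m + 1 + N), ((i : ℝ) ^ 2)⁻¹ := by
        rw [range_eq_Ico, map_add_left_Ico, add_zero, Finset.Ico_add_one_left_eq_Ioo]
    _ ≤ 2 / ((m : ℝ) + 1) := h

/-- **Cauchy–Schwarz along a ray** (Jones–Smirnov 2000, p. 274, `n = 2`): if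
`Σ_v (q v + 1)² rad v² = M < ∞` then `Σ_{n<N} rad (x (k+n)) ≤ √M √(2/(q (x 0) + k + 1))`, since
the levels `q (x (k+n)) = q (x 0) + k + n` are distinct. [cite: JonesSmirnov2000, §3 proof of Thm. 2 (p. 274)] -/
theorem sum_range_rad_ray_le (hq : ∀ v, v ≠ root → q v = q (parent v) + 1)
    (hx : ∀ n, parent (x (n + 1)) = x n) (hx0 : ∀ n, x (n + 1) ≠ root) (hrad : ∀ v, 0 ≤ rad v)
    (hsum : Summable fun v => ((q v : ℝ) + 1) ^ 2 * rad v ^ 2) (k N : ℕ) :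
    ∑ n ∈ range N, rad (x (k + n)) ≤
      Real.sqrt (∑' v, ((q v : ℝ) + 1) ^ 2 * rad v ^ 2) *
        Real.sqrt (2 / ((q (x 0) : ℝ) + k + 1)) := by
  classical
  set M : ℝ := ∑' v, ((q v : ℝ) + 1) ^ 2 * rad v ^ 2 with hM
  set a : ℕ → ℝ := fun n => ((q (x (k + n)) : ℝ) + 1) * rad (x (k + n)) with ha
  set b : ℕ → ℝ := fun n => 1 / (((q (x (k + n))) : ℝ) + 1) with hb
  have hab : ∀ n, rad (x (k + n)) = a n * b n := fun n => by
    simp only [ha, hb]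
    field_simp
  have hlevel : ∀ n, (q (x (k + n)) : ℝ) = (q (x 0) : ℝ) + k + n := fun n => by
    rw [q_apply_ray hq hx hx0 (k + n)]
    push_cast
    ring
  -- the two square sums
  have hA : ∑ n ∈ range N, a n ^ 2 ≤ M := by
    have hinj : Function.Injective fun n : ℕ => x (k + n) :=
      (injective_ray hq hx hx0).comp (add_right_injective k)
    calc ∑ n ∈ range N, a n ^ 2
        = ∑ n ∈ range N, (fun v => ((q v : ℝ) + 1) ^ 2 * rad v ^ 2) (x (k + n)) :=
          sum_congr rfl fun n _ => by simp only [ha]; ring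
      _ = ∑ v ∈ (range N).image fun n => x (k + n), ((q v : ℝ) + 1) ^ 2 * rad v ^ 2 := by
          rw [sum_image fun m _ n _ h => hinj h]
      _ ≤ M := hsum.sum_le_tsum _ fun v _ => by positivity
  have hB : ∑ n ∈ range N, b n ^ 2 ≤ 2 / ((q (x 0) : ℝ) + k + 1) := by
    have := sum_range_inv_sq_le (q (x 0) + k) N
    push_cast at this
    calc ∑ n ∈ range N, b n ^ 2 = ∑ n ∈ range N, (1 : ℝ) / (((q (x 0)) : ℝ) + k + 1 + n) ^ 2 :=
          sum_congr rfl fun n _ => by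
            rw [hb]
            dsimp only
            rw [hlevel n, div_pow, one_pow]
            congr 1
            ring
      _ ≤ 2 / ((q (x 0) : ℝ) + k + 1) := this
  -- Cauchy–Schwarz
  have hCS : (∑ n ∈ range N, a n * b n) ^ 2 ≤ (∑ n ∈ range N, a n ^ 2) * ∑ n ∈ range N, b n ^ 2 :=
    sum_mul_sq_le_sq_mul_sq _ _ _
  have hnonneg : 0 ≤ ∑ n ∈ range N, a n * b n :=
    sum_nonneg fun n _ => by rw [← hab]; exact hrad _
  calc ∑ n ∈ range N, rad (x (k + n)) = ∑ n ∈ range N, a n * b n := sum_congr rfl fun n _ => hab n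
    _ = Real.sqrt ((∑ n ∈ range N, a n * b n) ^ 2) := (Real.sqrt_sq hnonneg).symm
    _ ≤ Real.sqrt ((∑ n ∈ range N, a n ^ 2) * ∑ n ∈ range N, b n ^ 2) := Real.sqrt_le_sqrt hCS
    _ = Real.sqrt (∑ n ∈ range N, a n ^ 2) * Real.sqrt (∑ n ∈ range N, b n ^ 2) :=
        Real.sqrt_mul (sum_nonneg fun _ _ => by positivity) _
    _ ≤ Real.sqrt M * Real.sqrt (2 / ((q (x 0) : ℝ) + k + 1)) := by
        gcongr

/-- The radii along a ray are summable (from any index `k` on). [folklore] -/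
theorem summable_rad_ray (hq : ∀ v, v ≠ root → q v = q (parent v) + 1)
    (hx : ∀ n, parent (x (n + 1)) = x n) (hx0 : ∀ n, x (n + 1) ≠ root) (hrad : ∀ v, 0 ≤ rad v)
    (hsum : Summable fun v => ((q v : ℝ) + 1) ^ 2 * rad v ^ 2) (k : ℕ) :
    Summable fun n => rad (x (k + n)) :=
  summable_of_sum_range_le (fun _ => hrad _) fun N => sum_range_rad_ray_le hq hx hx0 hrad hsum k N

/-- **Tails of a ray are short** (Jones–Smirnov 2000, p. 274):
`Σ_{n ≥ 0} rad (x (k+n)) ≤ √(Σ_v (q v+1)² rad v²) · √(2/(q (x 0) + k + 1))`. [cite: JonesSmirnov2000, §3 proof of Thm. 2 (p. 274)] -/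
theorem tsum_rad_ray_le (hq : ∀ v, v ≠ root → q v = q (parent v) + 1)
    (hx : ∀ n, parent (x (n + 1)) = x n) (hx0 : ∀ n, x (n + 1) ≠ root) (hrad : ∀ v, 0 ≤ rad v)
    (hsum : Summable fun v => ((q v : ℝ) + 1) ^ 2 * rad v ^ 2) (k : ℕ) :
    ∑' n, rad (x (k + n)) ≤
      Real.sqrt (∑' v, ((q v : ℝ) + 1) ^ 2 * rad v ^ 2) *
        Real.sqrt (2 / ((q (x 0) : ℝ) + k + 1)) :=
  Real.tsum_le_of_sum_range_le (fun _ => hrad _) fun N => sum_range_rad_ray_le hq hx hx0 hrad hsum k N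

/-- Consecutive positions along a ray are close: `|pos (x n) - pos (x (n+1))| ≤ κ (rad (x (n+1)) +
rad (x n))`. [folklore] -/
theorem dist_pos_ray_succ_le (hpos : ∀ v, dist (pos v) (pos (parent v)) ≤ κ * (rad v + rad (parent v)))
    (hx : ∀ n, parent (x (n + 1)) = x n) (n : ℕ) :
    dist (pos (x n)) (pos (x (n + 1))) ≤ κ * (rad (x (n + 1)) + rad (x n)) := by
  rw [dist_comm, ← hx n]
  exact (hpos (x (n + 1))).trans_eq (by rw [hx n])

/-- **Rays land**: the positions along a ray form a Cauchy sequence. [cite: JonesSmirnov2000, §3 proof of Thm. 2 (p. 274)] -/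
theorem cauchySeq_pos_ray (hq : ∀ v, v ≠ root → q v = q (parent v) + 1)
    (hpos : ∀ v, dist (pos v) (pos (parent v)) ≤ κ * (rad v + rad (parent v)))
    (hx : ∀ n, parent (x (n + 1)) = x n) (hx0 : ∀ n, x (n + 1) ≠ root) (hrad : ∀ v, 0 ≤ rad v)
    (hsum : Summable fun v => ((q v : ℝ) + 1) ^ 2 * rad v ^ 2) :
    CauchySeq fun n => pos (x n) := by
  refine cauchySeq_of_dist_le_of_summable (fun n => κ * (rad (x (n + 1)) + rad (x n)))
    (dist_pos_ray_succ_le hpos hx) (Summable.mul_left κ (Summable.add ?_ ?_))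
  · simpa [add_comm] using summable_rad_ray hq hx hx0 hrad hsum 1
  · simpa using summable_rad_ray hq hx hx0 hrad hsum 0

/-- **Rays land**: the positions along a ray converge to a point of `ℂ` (its landing point).
[cite: JonesSmirnov2000, §3 proof of Thm. 2 (p. 274)] -/
theorem exists_tendsto_pos_ray (hq : ∀ v, v ≠ root → q v = q (parent v) + 1)
    (hpos : ∀ v, dist (pos v) (pos (parent v)) ≤ κ * (rad v + rad (parent v)))
    (hx : ∀ n, parent (x (n + 1)) = x n) (hx0 : ∀ n, x (n + 1) ≠ root) (hrad : ∀ v, 0 ≤ rad v)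
    (hsum : Summable fun v => ((q v : ℝ) + 1) ^ 2 * rad v ^ 2) :
    ∃ a : ℂ, Tendsto (fun n => pos (x n)) atTop (𝓝 a) :=
  cauchySeq_tendsto_of_complete (cauchySeq_pos_ray hq hpos hx hx0 hrad hsum)

/-- **Uniform tail estimate for the landing point** (Jones–Smirnov 2000, p. 274: "the lengths of
their tails tend uniformly to zero"): if the positions along a ray tend to `a`, then for every `k`
`|pos (x k) - a| ≤ 2κ √(Σ_v (q v+1)² rad v²) √(2/(q (x 0) + k + 1))`. [cite: JonesSmirnov2000, §3 proof of Thm. 2 (p. 274)] -/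
theorem dist_pos_ray_le (hq : ∀ v, v ≠ root → q v = q (parent v) + 1)
    (hpos : ∀ v, dist (pos v) (pos (parent v)) ≤ κ * (rad v + rad (parent v))) (hκ : 0 ≤ κ)
    (hx : ∀ n, parent (x (n + 1)) = x n) (hx0 : ∀ n, x (n + 1) ≠ root) (hrad : ∀ v, 0 ≤ rad v)
    (hsum : Summable fun v => ((q v : ℝ) + 1) ^ 2 * rad v ^ 2) {a : ℂ}
    (ha : Tendsto (fun n => pos (x n)) atTop (𝓝 a)) (k : ℕ) :
    dist (pos (x k)) a ≤ 2 * κ * (Real.sqrt (∑' v, ((q v : ℝ) + 1) ^ 2 * rad v ^ 2) *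
      Real.sqrt (2 / ((q (x 0) : ℝ) + k + 1))) := by
  set B : ℝ := Real.sqrt (∑' v, ((q v : ℝ) + 1) ^ 2 * rad v ^ 2) *
      Real.sqrt (2 / ((q (x 0) : ℝ) + k + 1)) with hB
  have hs0 := summable_rad_ray hq hx hx0 hrad hsum k
  have hs1 := summable_rad_ray hq hx hx0 hrad hsum (k + 1)
  have hd : Summable fun n => κ * (rad (x (n + 1)) + rad (x n)) := by
    refine Summable.mul_left κ (Summable.add ?_ ?_)
    · simpa [add_comm] using summable_rad_ray hq hx hx0 hrad hsum 1
    · simpa using summable_rad_ray hq hx hx0 hrad hsum 0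
  have h := dist_le_tsum_of_dist_le_of_tendsto (fun n => κ * (rad (x (n + 1)) + rad (x n)))
    (dist_pos_ray_succ_le hpos hx) hd ha k
  -- `Σ_m κ (rad (x (k+m+1)) + rad (x (k+m))) ≤ κ (B + B)`
  have h0 : ∑' m, rad (x (k + m)) ≤ B := tsum_rad_ray_le hq hx hx0 hrad hsum k
  have h1 : ∑' m, rad (x (k + m + 1)) ≤ B := by
    have h1' := tsum_rad_ray_le hq hx hx0 hrad hsum (k + 1)
    have hle : Real.sqrt (2 / ((q (x 0) : ℝ) + (k + 1 : ℕ) + 1)) ≤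
        Real.sqrt (2 / ((q (x 0) : ℝ) + k + 1)) := by
      push_cast
      gcongr
      · linarith
    calc ∑' m, rad (x (k + m + 1)) = ∑' m, rad (x (k + 1 + m)) :=
          tsum_congr fun m => by rw [add_right_comm]
      _ ≤ _ := h1'
      _ ≤ B := by rw [hB]; gcongr
  have hs1' : Summable fun m => rad (x (k + m + 1)) :=
    hs1.congr fun m => by rw [add_right_comm]
  calc dist (pos (x k)) a ≤ ∑' m, κ * (rad (x (k + m + 1)) + rad (x (k + m))) := h
    _ = κ * ((∑' m, rad (x (k + m + 1))) + ∑' m, rad (x (k + m))) := by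
        rw [tsum_mul_left, hs1'.tsum_add hs0]
    _ ≤ κ * (B + B) := by gcongr
    _ = 2 * κ * B := by ring

end Rays

end Literature.Probability.RandomPlanarGeometry
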